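import Mathlib
import Summits.ResolutionOfSingularities.ResolutionOfSingularities.Theorems.RadicialJungCleanModelsCleanProp44BirthCount
import HarnessLib

/-!
# Route `RadicialJung`, crux `CleanModels` (stmt-ResolutionOfSingularities-15917), line `Sketch` rev 35, stub 6 `stub_cleanProp44` (X44c):
# THE DEGREE COUNT ON A SUCCESSOR LINE — `deg λ ≤ δ`, `p ∣ δ ⟹ deg λ′ ≤ δ − 2`, hence `Σ(ν − 1)[κ(c′):κ] ≤ δ − 2` (census (iii-3) (c), polynomial half)

Seat decomp-res-hand-2 g20 (structural hand); sequel of ✓ `…CleanProp44BirthCount.lean` and ✓ `…CleanProp44LeafTowerStep.lean`.  Memo 4e §2.5: when the `δ`-face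
`Σ_e T^e C_e(u)` (`C_μ = c` a non-zero constant, `deg C_e ≤ (μ−e)δ`) is SOLVABLE, `= c·(T + λ(u))^μ`, the successor line `Γ″ = V(u₁, t_δ + λ(u₂′))` carries the
restricted unit `U|_{Γ″} = −v(c)·λ(u₂′)`; «DEGREE COUNT: `dλ = λ′(u)du` with `deg λ′ ≤ δ − 2` (the coefficient of `u^{δ−1}` in `λ′` is `δ·λ_δ = 0` because `p ∣ δ`),
so … `Σ_{births c′} (r*(c′) − 1)·[κ(c′):κ(c)] ≤ δ − 2`».  This file types the polynomial half (pure algebra over a field `κ` of characteristic `p`, def-free):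

* `natDegree_le_of_C_mul_pow_eq` — `c·λ^μ = C₀` with `c ≠ 0`, `μ ≥ 1`, `deg C₀ ≤ μ·d` ⟹ `deg λ ≤ d` (the constant term of a solvable face bounds `deg λ`).
* `natDegree_derivative_le_sub_two` — `deg λ ≤ d` and `(d : κ) = 0` (i.e. `p ∣ d`) ⟹ `deg λ′ ≤ d − 2`.
* `sum_mul_natDegree_le_sub_two` — **THE COUNT ON `Γ″`**: for `F = a·λ` (`a ≠ 0` the constant `−v(c)`), `λ′ ≠ 0`, `deg λ ≤ d`, `p ∣ d`, and distinct closed points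
  `(P_i)` with `F·S_i^p + B_i^p ∈ (P_i)^{e_i+1}` (`P_i ∤ S_i`): `Σ_i e_i·deg P_i ≤ d − 2` (✓ `sum_mul_natDegree_le_of_add_pow_mem` with `D = d/du`).

Honest framing: OURS, elementary; the solvability of the face and the identification `U|_{Γ″} = −v(c)λ` are (iii-3) (c) proper and NOT done here; nothing here proves
X44c, any case of `CleanModels`, or resolution of singularities in characteristic `p`. [cite: CossartPiltant2008, Prop. 4.4 (proof, p. 11)]
[cite: CossartPiltant2009, ch.1 II.5.3.2 (i)]
-/

noncomputable section

set_option linter.dupNamespace false -- mandated namespace of this single-conjunct summit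

open Polynomial

namespace Summit.ResolutionOfSingularities.ResolutionOfSingularities.Theorems.RadicialJung.CleanModels

variable {k : Type*} [Field k]

/-- **`deg λ ≤ d` from the constant term of a solvable face**: `c·λ^μ = C₀`, `c ≠ 0`, `1 ≤ μ`, `deg C₀ ≤ μ·d` ⟹ `deg λ ≤ d`. [folklore] -/
theorem natDegree_le_of_C_mul_pow_eq {c : k} (hc : c ≠ 0) {lam C₀ : k[X]} {μ d : ℕ} (hμ : 1 ≤ μ) (h : C c * lam ^ μ = C₀)
    (hC₀ : C₀.natDegree ≤ μ * d) : lam.natDegree ≤ d := by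
  have h1 : (C c * lam ^ μ).natDegree = μ * lam.natDegree := by
    rw [natDegree_C_mul hc, natDegree_pow]
  have h2 : μ * lam.natDegree ≤ μ * d := by rw [← h1, h]; exact hC₀
  exact Nat.le_of_mul_le_mul_left h2 (by omega)

/-- **`p ∣ d` kills the top coefficient of `λ′`**: `deg λ ≤ d`, `(d : κ) = 0` ⟹ `deg λ′ ≤ d − 2`. [folklore] -/
theorem natDegree_derivative_le_sub_two {lam : k[X]} {d : ℕ} (hdeg : lam.natDegree ≤ d) (hd : (d : k) = 0) :
    (derivative lam).natDegree ≤ d - 2 := by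
  rw [natDegree_le_iff_coeff_eq_zero]
  intro n hn
  rw [coeff_derivative]
  by_cases h1 : n + 1 = d
  · -- the top coefficient: `λ_d · d = 0`
    have h2 : ((n : k) + 1) = (d : k) := by rw [← h1]; push_cast; ring
    rw [h2, hd, mul_zero]
  · -- above the degree of `λ`
    have h3 : d < n + 1 := by omega
    rw [coeff_eq_zero_of_natDegree_lt (lt_of_le_of_lt hdeg h3), zero_mul]

/-- **THE COUNT ON A SUCCESSOR LINE `Γ″`** (memo 4e §2.5 «the number of births (with weights) is `≤ δ − 2`», for every residue field as long as `λ′ ≢ 0`):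
`F = a·λ` with `a ≠ 0`, `deg λ ≤ d`, `p ∣ d` (as `(d : κ) = 0`), `λ′ ≠ 0`; distinct closed points `(P_i)` of the line with `F·S_i^p + B_i^p ∈ (P_i)^{e_i+1}`
(`P_i ∤ S_i`; «`ν(c′_i) ≥ e_i + 1`»).  Then `Σ_i e_i·deg P_i ≤ d − 2`. [cite: CossartPiltant2008, Prop. 4.4 (proof, p. 11)] [cite: CossartPiltant2009, ch.1 II.5.3.2 (i)] -/
theorem sum_mul_natDegree_le_sub_two (p : ℕ) [Fact p.Prime] [CharP k p] {a : k} (ha : a ≠ 0) {lam : k[X]} {d : ℕ} (hdeg : lam.natDegree ≤ d)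
    (hd : (d : k) = 0) (hlam : derivative lam ≠ 0) {ι : Type*} (s : Finset ι) (P S B : ι → k[X]) (e : ι → ℕ)
    (hP : ∀ i ∈ s, Prime (P i)) (hne : ∀ i ∈ s, ∀ j ∈ s, i ≠ j → ¬ P i ∣ P j) (hS : ∀ i ∈ s, ¬ P i ∣ S i)
    (h : ∀ i ∈ s, C a * lam * S i ^ p + B i ^ p ∈ Ideal.span {P i} ^ (e i + 1)) :
    ∑ i ∈ s, e i * (P i).natDegree ≤ d - 2 := by
  have hD : (derivative' : Derivation k k[X] k[X]) (C a * lam) ≠ 0 := by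
    show derivative (C a * lam) ≠ 0
    rw [derivative_C_mul]
    exact mul_ne_zero (by rwa [Ne, C_eq_zero]) hlam
  have key := sum_mul_natDegree_le_of_add_pow_mem p (derivative' : Derivation k k[X] k[X]) hD s P S B e hP hne hS h
  refine key.trans ?_
  show (derivative (C a * lam)).natDegree ≤ d - 2
  rw [derivative_C_mul, natDegree_C_mul ha]
  exact natDegree_derivative_le_sub_two hdeg hd

end Summit.ResolutionOfSingularities.ResolutionOfSingularities.Theorems.RadicialJung.CleanModels

end
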